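import Literature.IUT.HodgeArakelov.EtaleThetaDataOfSetting
import HarnessLib

/-!
# [IUTchII] Cor. 2.5 (i) at the GENUINE Prop. 1.4 output: the generator hypothesis `hgen`
# («`(l·Δ_Θ)(Π_v)` is generated over its bottom group by the cuspidal inertia groups») REDUCED to one
# [EtTh]-level clause on the position of the cuspidal inertia of `Π^tp_{X̲̲_v}` (proof-only, 0 definitions)

S. Mochizuki, *Inter-universal Teichmüller theory II*, kurims manuscript (Dec. 2020), §2, Cor. 2.5 (i) p. 71
l. 33–37 («the inclusion `Π_{v⩒▶} ↪ Π_v` induces an isomorphism `(l·Δ_Θ)(Π_{v⩒▶}) ⥲ (l·Δ_Θ)(Π_v)`»), proof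
p. 72 l. 35–38 («follows immediately by considering the cuspidal inertia groups involved»)
[claim: Mochizuki2012, status: disputed] (IUTchII §2 Cor 2.5 (i), kurims p.71); S. Mochizuki, *The étale theta
function …*, Publ. RIMS **45** (2009) [EtTh], §1 p. 12 («`Δ_Θ (≅ Ẑ(1))`», the image of `∧² Δ^ell_X`), §2 p. 35
(«a natural injective homomorphism `D_x → Π^Θ_X` … which maps the inertia group `I_x ⊆ D_x` isomorphically onto
`Δ̄_Θ`») [cite: MochizukiEtTh2009, §1 p.12]. abc-iut cell, layer L6, node **IUTchII:Cor2.5(i)**, residual J1 =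
GAP-LEDGER **G-w4d005g4-1** (abc-iut-w4-d005 gen 4, 2026-08-26T08:29Z); seat abc-iut-w4-d024 (gen 5).

THE RESIDUAL. abc-iut-w4-d005's `Subquotient.inf_sup_bot_eq_top_of_generators` (p431116,
`ThetaEvaluationSubgraphsCor25Proofs.lean`) proves the printed isomorphism of Cor. 2.5 (i) from the hypothesis
`hgen : S.top = S.bot ⊔ ⨆ t, I t` — at the [IUTchII] §1–§2 frame: «the top group of `(l·Δ_Θ)(Π_v)` is generated
over its bottom group by the cuspidal inertia groups `I_t`». At that frame `EtaleThetaData.lDeltaTheta`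
(abc-iut-L6-t1, p406189) and `CuspidalInertiaData` (p407174) are unrelated bare data, so `hgen` is a junction, not
a theorem. HERE `hgen` is proved at the GENUINE Prop. 1.4 output of abc-iut-L6-t1's bridge
`etaleThetaDataOfSetting` / `etaleThetaDataOfSetting'` (`EtaleThetaDataOfSetting.lean`): `Π := Π^tp_{X̲̲}`
(abc-iut-L2-t8's `C : E.DoubleUnderline l` over abc-iut-L2-t1's §1 root `D : ThetaSetting p`),
`(l·Δ_Θ)(Π) := lDeltaSubquotient C = φ⁻¹(l·Δ_Θ) / Ker φ`, `φ = toTheta ∘ incl : Π^tp_{X̲̲} → (Π^tp_X)^Θ` —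
MODULO exactly one [EtTh]-level clause, for EVERY push-forward `ε : Π^tp_{X̲̲} →* Q` (the consumer's
`W.emb.comp T.incl` into `Π̂^cor_v`) and EVERY family `J` of subgroups of `Q` that is the `ε`-image of subgroups
`I t ≤ Π^tp_{X̲̲}` (the consumer's cuspidal inertia groups of `Π_v`):

* §0 generic group theory (private helpers `comap_eq_ker_sup_iSup_of_map_le`, `comap_eq_ker_sup_of_map_eq`,
  `inf_sup_eq_of_eq_sup_iSup`): `φ⁻¹(S) = Ker φ ⊔ ⨆ I t` as soon as `φ(I t) ≤ S` for all `t` and `S ≤ ⨆ φ(I t)`;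
* §1 **`lDeltaSubquotient_top_eq_bot_sup_iSup`** / **`…_top_eq_bot_sup`** (single subgroup with
  `φ(I) = l·Δ_Θ`) / **`map_lDeltaSubquotient_top_eq`** (pushed forward along any `ε`) /
  **`etaleThetaDataOfSetting_hgen`**, **`etaleThetaDataOfSetting'_hgen`** — the consumer's `hgen` VERBATIM for the
  genuine `D`, and **`etaleThetaDataOfSetting'_cor25i`** — Cor. 2.5 (i)'s conclusion
  `((top).map ε ⊓ H) ⊔ (bot).map ε = (top).map ε` for every `H ≥ J t` (the consumer's `Π_{v⩒▶}`, Cor. 2.4 (ii)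
  `I^δ_t ⊆ Π^δ_{v⩒▶}`), all ⟸ THE CLAUSE «`φ(I t) ⊆ l·Δ_Θ` for every `t` and `l·Δ_Θ ⊆ ⨆_t φ(I t)`» — the
  `θ`-images of the cuspidal inertia subgroups of `Π^tp_{X̲̲_v}` lie in and generate `l·Δ_Θ`;
* §1b the reduction is EXACT (`lDeltaTheta_le_range_phi`: `l·Δ_Θ ⊆ range φ` by abc-iut-L2-t8's `map_toTheta_Huu`;
  `clause_of_lDeltaSubquotient_top_eq`; **`lDeltaSubquotient_top_eq_bot_sup_iSup_iff`**;
  **`etaleThetaDataOfSetting'_hgen_iff`** / **`…_hgen_iff_comap`**): for an INJECTIVE push-forward `ε`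
  (`Π_v ↪ Π̂^cor_v`) the consumer's `hgen` at the genuine output holds IF AND ONLY IF the clause holds — the clause
  is THE content of residual J1 there, not merely a sufficient condition;
* §2 **`map_phi_inertia_inf_eq_lDeltaTheta`**: that clause (single-cusp form `φ(I_x ∩ Π^tp_{X̲̲}) = l·Δ_Θ`)
  follows from the `Π^tp_X`-level cusp-position clause «`toTheta(I_x) = Δ_Θ`» for a cusp `x` of `X`
  (`I_x = D.inertia x`, [SemiAnbd] §6 p. 71 / [EtTh] §2 p. 35: `I_x ⥲ Δ_Θ`, the `Ẑ`-level form of the binder of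
  GAP-LEDGER G-L2t10-3, abc-iut-L2-t10 `Sec2InertiaBinderOfHat`) together with «`Ker toTheta ≤ Π^tp_{X̲̲}`»
  (the covering `X̲̲ → X` is dominated by `Π^tp_X ↠ (Π^tp_X)^Θ`, [EtTh] Def. 2.1–2.5), using abc-iut-L2-t8's field
  `map_toTheta_Huu : toTheta(Π^tp_{X̲̲}) ∩ Δ_Θ = l·Δ_Θ`; **`etaleThetaDataOfSetting'_hgen_of_cuspPosition`** chains
  §1 and §2.

SO: J1 is not a new fact and not a [IUTchII]-level statement — it is the SAME interface junction layer L2 already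
records (the POSITION of the cusp's inertia in `Δ_X`: `SemiGraphs.TemperedCurve` / `ThetaSetting` give
`I_x ≅ Ẑ(1)` abstractly only; G-L2t10-3). HONEST LIMITS: a REDUCTION, not a discharge — the clause is a
hypothesis here and no model in the tree satisfies it (abc-iut-L2-t10 gen 5's label: the χ-model's synthetic
cusp has toral inertia); nothing of [EtTh] is asserted; no new `def`, no new `Prop` fact, zero edit of any other
seat's file; no side is taken on [IUTchIII] Cor. 3.12; typed ≠ proved.
-/

noncomputable section

namespace Literature.IUT.HodgeArakelov

namespace EtaleThetaDataOfSetting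

/-! ### 0. Generic group theory: a preimage subgroup is generated over the kernel by lifts of generators -/

section Generic

variable {G H : Type*} [Group G] [Group H]

/-- If the images `φ(I t)` all lie in `S` and jointly generate a subgroup containing `S`, then
`φ⁻¹(S) = Ker φ ⊔ ⨆ t, I t`: every `x` with `φ x ∈ S` is a product `k · y` with `φ k = 1` and `y ∈ ⨆ I t`.
[folklore] -/
private theorem comap_eq_ker_sup_iSup_of_map_le (φ : G →* H) (S : Subgroup H) {ι : Sort*} (I : ι → Subgroup G)
    (hle : ∀ t, (I t).map φ ≤ S) (hgen : S ≤ ⨆ t, (I t).map φ) :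
    S.comap φ = φ.ker ⊔ ⨆ t, I t := by
  apply le_antisymm
  · intro x hx
    rw [Subgroup.mem_comap] at hx
    have hx' : φ x ∈ (⨆ t, I t).map φ := by
      rw [Subgroup.map_iSup]
      exact hgen hx
    obtain ⟨y, hy, hyx⟩ := hx'
    have hxy : x = (x * y⁻¹) * y := by rw [inv_mul_cancel_right]
    rw [hxy]
    refine Subgroup.mul_mem_sup ?_ hy
    rw [MonoidHom.mem_ker, map_mul, map_inv, hyx, mul_inv_cancel]
  · refine sup_le (fun x hx => ?_) (iSup_le fun t => ?_)
    · rw [MonoidHom.mem_ker] at hx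
      rw [Subgroup.mem_comap, hx]
      exact one_mem _
    · rw [← Subgroup.map_le_iff_le_comap]
      exact hle t

/-- Single-subgroup form: if `φ(I) = S` then `φ⁻¹(S) = Ker φ ⊔ I`. [folklore] -/
private theorem comap_eq_ker_sup_of_map_eq (φ : G →* H) (S : Subgroup H) (I : Subgroup G) (hI : I.map φ = S) :
    S.comap φ = φ.ker ⊔ I := by
  have h := comap_eq_ker_sup_iSup_of_map_le φ S (fun _ : Unit => I) (fun _ => hI.le)
    (by rw [iSup_const]; exact hI.ge)
  rwa [iSup_const] at h

/-- The lattice bookkeeping behind Cor. 2.5 (i) (same argument as abc-iut-w4-d005's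
`Subquotient.inf_sup_bot_eq_top_of_generators`, stated for bare subgroups so that it applies to pushed-forward
data): if `A = B ⊔ ⨆ J t` with `B ≤ A` and every `J t ≤ H`, then `(A ⊓ H) ⊔ B = A`. [folklore] -/
private theorem inf_sup_eq_of_eq_sup_iSup {Q : Type*} [Group Q] {A B H : Subgroup Q} {ι : Sort*} (J : ι → Subgroup Q)
    (hA : A = B ⊔ ⨆ t, J t) (hJ : ∀ t, J t ≤ H) : (A ⊓ H) ⊔ B = A := by
  have hBA : B ≤ A := by rw [hA]; exact le_sup_left
  apply le_antisymm
  · exact sup_le inf_le_left hBA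
  · have hJA : (⨆ t, J t) ≤ A := by rw [hA]; exact le_sup_right
    calc A = B ⊔ ⨆ t, J t := hA
      _ ≤ B ⊔ (A ⊓ H) := sup_le_sup_left (le_inf hJA (iSup_le hJ)) _
      _ = (A ⊓ H) ⊔ B := sup_comm _ _

end Generic

/-! ### 1. `hgen` at the genuine Prop. 1.4 output `(l·Δ_Θ)(Π^tp_{X̲̲}) = φ⁻¹(l·Δ_Θ)/Ker φ` -/

variable {p : ℕ} [Fact p.Prime] {D : Literature.AnabelianGeometry.EtaleTheta.ThetaSetting p}
  {E : D.EtaleThetaData} {l : ℕ} (C : E.DoubleUnderline l)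

/-- **Cor. 2.5 (i)'s generator clause at the genuine `(l·Δ_Θ)(Π^tp_{X̲̲})`**: if the `θ`-images of a family of
subgroups `I t ≤ Π^tp_{X̲̲}` («the cuspidal inertia groups involved», p. 72) lie in and generate `l·Δ_Θ`, then
the top group `φ⁻¹(l·Δ_Θ)` of abc-iut-L6-t1's `lDeltaSubquotient C` is generated over its bottom group `Ker φ`
by the `I t`. [claim: Mochizuki2012, status: disputed] (IUTchII §2 Cor 2.5 (i), kurims p.71) -/
theorem lDeltaSubquotient_top_eq_bot_sup_iSup {ι : Sort*} (I : ι → Subgroup (Pi C))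
    (hle : ∀ t, (I t).map (phi C) ≤ D.lDeltaTheta l) (hgen : D.lDeltaTheta l ≤ ⨆ t, (I t).map (phi C)) :
    (lDeltaSubquotient C).top = (lDeltaSubquotient C).bot ⊔ ⨆ t, I t :=
  comap_eq_ker_sup_iSup_of_map_le (phi C) (D.lDeltaTheta l) I hle hgen

/-- Single-cusp form: ONE subgroup `I ≤ Π^tp_{X̲̲}` with `φ(I) = l·Δ_Θ` already generates the top group of
`(l·Δ_Θ)(Π^tp_{X̲̲})` over its bottom group. [claim: Mochizuki2012, status: disputed] (IUTchII §2 Cor 2.5 (i), kurims p.71) -/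
theorem lDeltaSubquotient_top_eq_bot_sup (I : Subgroup (Pi C)) (hI : I.map (phi C) = D.lDeltaTheta l) :
    (lDeltaSubquotient C).top = (lDeltaSubquotient C).bot ⊔ I :=
  comap_eq_ker_sup_of_map_eq (phi C) (D.lDeltaTheta l) I hI

/-- **Pushed forward** along any homomorphism `ε : Π^tp_{X̲̲} →* Q` (the consumer's `W.emb.comp T.incl` into
`Π̂^cor_v`): for a family `J` of subgroups of `Q` that is the `ε`-image of subgroups `I t ≤ Π^tp_{X̲̲}` whose
`θ`-images lie in and generate `l·Δ_Θ`, `(top).map ε = (bot).map ε ⊔ ⨆ t, J t` — the exact shape of the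
hypothesis `hgen` of `Subquotient.inf_sup_bot_eq_top_of_generators` (p431116).
[claim: Mochizuki2012, status: disputed] (IUTchII §2 Cor 2.5 (i), kurims p.71) -/
theorem map_lDeltaSubquotient_top_eq {Q : Type*} [Group Q] (ε : Pi C →* Q) {ι : Sort*}
    (I : ι → Subgroup (Pi C)) (J : ι → Subgroup Q) (hIJ : ∀ t, (I t).map ε = J t)
    (hle : ∀ t, (I t).map (phi C) ≤ D.lDeltaTheta l) (hgen : D.lDeltaTheta l ≤ ⨆ t, (I t).map (phi C)) :
    ((lDeltaSubquotient C).top).map ε = ((lDeltaSubquotient C).bot).map ε ⊔ ⨆ t, J t := by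
  rw [lDeltaSubquotient_top_eq_bot_sup_iSup C I hle hgen, Subgroup.map_sup, Subgroup.map_iSup]
  simp_rw [hIJ]

/-- **`hgen` for the genuine bridge `etaleThetaDataOfSetting`** (abc-iut-L6-t1's [IUTchII] Prop. 1.4 output at
`Π := Π^tp_{X̲̲}`, any admissible `S`, `eS`, (H1) `hchar`): the consumer's hypothesis VERBATIM, for every
push-forward `ε` and every family `J` of `ε`-images of subgroups of `Π^tp_{X̲̲}` whose `θ`-images lie in and
generate `l·Δ_Θ`. [claim: Mochizuki2012, status: disputed] (IUTchII §2 Cor 2.5 (i), kurims p.71) -/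
theorem etaleThetaDataOfSetting_hgen (hC : D.Compat) (hS : D.Sec2Hyps) (hchar : PiYddCharacteristic C)
    (S : ThetaSetting.{0}) (eS : (Pi C) ≃ₜ* S.PiX) {Q : Type*} [Group Q] (ε : Pi C →* Q) {ι : Sort*}
    (I : ι → Subgroup (Pi C)) (J : ι → Subgroup Q) (hIJ : ∀ t, (I t).map ε = J t)
    (hle : ∀ t, (I t).map (phi C) ≤ D.lDeltaTheta l) (hgen : D.lDeltaTheta l ≤ ⨆ t, (I t).map (phi C)) :
    ((etaleThetaDataOfSetting C hC hS hchar S eS).lDeltaTheta.top).map ε =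
      ((etaleThetaDataOfSetting C hC hS hchar S eS).lDeltaTheta.bot).map ε ⊔ ⨆ t, J t :=
  map_lDeltaSubquotient_top_eq C ε I J hIJ hle hgen

/-- **`hgen` for the genuine bridge `etaleThetaDataOfSetting'`** (v2, one-root orbit, binder `S.l = l`): the
consumer's hypothesis VERBATIM under the same clause. [claim: Mochizuki2012, status: disputed] (IUTchII §2 Cor 2.5 (i), kurims p.71) -/
theorem etaleThetaDataOfSetting'_hgen (hC : D.Compat) (hS : D.Sec2Hyps) (hchar : PiYddCharacteristic C)
    (S : ThetaSetting.{0}) (eS : (Pi C) ≃ₜ* S.PiX) (hl : S.l = l) {Q : Type*} [Group Q] (ε : Pi C →* Q)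
    {ι : Sort*} (I : ι → Subgroup (Pi C)) (J : ι → Subgroup Q) (hIJ : ∀ t, (I t).map ε = J t)
    (hle : ∀ t, (I t).map (phi C) ≤ D.lDeltaTheta l) (hgen : D.lDeltaTheta l ≤ ⨆ t, (I t).map (phi C)) :
    ((etaleThetaDataOfSetting' C hC hS hchar S eS hl).lDeltaTheta.top).map ε =
      ((etaleThetaDataOfSetting' C hC hS hchar S eS hl).lDeltaTheta.bot).map ε ⊔ ⨆ t, J t :=
  map_lDeltaSubquotient_top_eq C ε I J hIJ hle hgen

/-- **IUTchII:Cor2.5(i) at the genuine Prop. 1.4 output, modulo the clause**: for every `H ≤ Q` containing the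
`J t` (the consumer's `Π_{v⩒▶}`; Cor. 2.4 (ii) «`I^δ_t ⊆ Π^δ_{v⩒▶}`»), `((top).map ε ⊓ H) ⊔ (bot).map ε = (top).map ε`
— «the inclusion `Π_{v⩒▶} ↪ Π_v` induces an isomorphism `(l·Δ_Θ)(Π_{v⩒▶}) ⥲ (l·Δ_Θ)(Π_v)`» (onto; into is
automatic), exactly as p431116 concludes it from `hgen`.
[claim: Mochizuki2012, status: disputed] (IUTchII §2 Cor 2.5 (i), kurims p.71) -/
theorem etaleThetaDataOfSetting'_cor25i (hC : D.Compat) (hS : D.Sec2Hyps) (hchar : PiYddCharacteristic C)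
    (S : ThetaSetting.{0}) (eS : (Pi C) ≃ₜ* S.PiX) (hl : S.l = l) {Q : Type*} [Group Q] (ε : Pi C →* Q)
    {ι : Sort*} (I : ι → Subgroup (Pi C)) (J : ι → Subgroup Q) (hIJ : ∀ t, (I t).map ε = J t)
    (hle : ∀ t, (I t).map (phi C) ≤ D.lDeltaTheta l) (hgen : D.lDeltaTheta l ≤ ⨆ t, (I t).map (phi C))
    (H : Subgroup Q) (hJH : ∀ t, J t ≤ H) :
    (((etaleThetaDataOfSetting' C hC hS hchar S eS hl).lDeltaTheta.top).map ε ⊓ H) ⊔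
        ((etaleThetaDataOfSetting' C hC hS hchar S eS hl).lDeltaTheta.bot).map ε =
      ((etaleThetaDataOfSetting' C hC hS hchar S eS hl).lDeltaTheta.top).map ε :=
  inf_sup_eq_of_eq_sup_iSup J (etaleThetaDataOfSetting'_hgen C hC hS hchar S eS hl ε I J hIJ hle hgen) hJH

/-! ### 1b. The reduction is EXACT: at the genuine output, `hgen` ⟺ the clause -/

/-- The range of `φ = toTheta ∘ incl : Π^tp_{X̲̲} → (Π^tp_X)^Θ` is `toTheta(Π^tp_{X̲̲})`. [cite: MochizukiEtTh2009, Def 2.5 (i) p.39] -/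
theorem range_phi : (phi C).range = C.Huu.map D.toTheta := by
  change (D.toTheta.comp C.Huu.subtype).range = _
  rw [MonoidHom.range_comp, Subgroup.range_subtype]

/-- `l·Δ_Θ ⊆ toTheta(Π^tp_{X̲̲})` (abc-iut-L2-t8's `map_toTheta_Huu`: `toTheta(Π^tp_{X̲̲}) ∩ Δ_Θ = l·Δ_Θ`), i.e. `l·Δ_Θ`
lies in the range of `φ`. [cite: MochizukiEtTh2009, Prop 2.12 (i) p.45] -/
theorem lDeltaTheta_le_range_phi : D.lDeltaTheta l ≤ (phi C).range := by
  rw [range_phi, ← C.map_toTheta_Huu]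
  exact inf_le_left

/-- **Necessity**: if the top group of the genuine `(l·Δ_Θ)(Π^tp_{X̲̲})` IS generated over its bottom group by a
family `I t`, then the `θ`-images `φ(I t)` lie in and generate `l·Δ_Θ` (because `l·Δ_Θ ⊆ range φ`). So the clause
is not a convenient sufficient condition but THE content of `hgen` at the genuine output.
[claim: Mochizuki2012, status: disputed] (IUTchII §2 Cor 2.5 (i), kurims p.71) -/
theorem clause_of_lDeltaSubquotient_top_eq {ι : Sort*} (I : ι → Subgroup (Pi C))
    (h : (lDeltaSubquotient C).top = (lDeltaSubquotient C).bot ⊔ ⨆ t, I t) :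
    (∀ t, (I t).map (phi C) ≤ D.lDeltaTheta l) ∧ D.lDeltaTheta l ≤ ⨆ t, (I t).map (phi C) := by
  constructor
  · intro t
    rw [Subgroup.map_le_iff_le_comap]
    change I t ≤ (lDeltaSubquotient C).top
    rw [h]
    exact le_sup_of_le_right (le_iSup I t)
  · intro z hz
    obtain ⟨x, rfl⟩ := lDeltaTheta_le_range_phi C hz
    have hx : x ∈ (lDeltaSubquotient C).top := Subgroup.mem_comap.2 hz
    rw [h] at hx
    have hφx : (phi C) x ∈ ((phi C).ker ⊔ ⨆ t, I t).map (phi C) := ⟨x, hx, rfl⟩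
    rwa [Subgroup.map_sup, (Subgroup.map_eq_bot_iff _).2 le_rfl, bot_sup_eq, Subgroup.map_iSup] at hφx

/-- **`hgen` ⟺ the clause** at the genuine `(l·Δ_Θ)(Π^tp_{X̲̲})` (un-pushed form).
[claim: Mochizuki2012, status: disputed] (IUTchII §2 Cor 2.5 (i), kurims p.71) -/
theorem lDeltaSubquotient_top_eq_bot_sup_iSup_iff {ι : Sort*} (I : ι → Subgroup (Pi C)) :
    (lDeltaSubquotient C).top = (lDeltaSubquotient C).bot ⊔ ⨆ t, I t ↔
      (∀ t, (I t).map (phi C) ≤ D.lDeltaTheta l) ∧ D.lDeltaTheta l ≤ ⨆ t, (I t).map (phi C) :=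
  ⟨clause_of_lDeltaSubquotient_top_eq C I, fun h => lDeltaSubquotient_top_eq_bot_sup_iSup C I h.1 h.2⟩

/-- **The consumer's `hgen` ⟺ the clause**, pushed forward along an INJECTIVE `ε : Π^tp_{X̲̲} →* Q` (the consumer's
`W.emb.comp T.incl` is injective: `Π_v ↪ Π̂^cor_v`): for the genuine bridge `etaleThetaDataOfSetting'` and a
family `J t = ε(I t)`, p431116's hypothesis holds IF AND ONLY IF the `θ`-images of the `I t` lie in and generate
`l·Δ_Θ` — the exact content of residual J1 at the genuine Prop. 1.4 output.
[claim: Mochizuki2012, status: disputed] (IUTchII §2 Cor 2.5 (i), kurims p.71) -/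
theorem etaleThetaDataOfSetting'_hgen_iff (hC : D.Compat) (hS : D.Sec2Hyps) (hchar : PiYddCharacteristic C)
    (S : ThetaSetting.{0}) (eS : (Pi C) ≃ₜ* S.PiX) (hl : S.l = l) {Q : Type*} [Group Q] (ε : Pi C →* Q)
    (hε : Function.Injective ε) {ι : Sort*} (I : ι → Subgroup (Pi C)) (J : ι → Subgroup Q)
    (hIJ : ∀ t, (I t).map ε = J t) :
    ((etaleThetaDataOfSetting' C hC hS hchar S eS hl).lDeltaTheta.top).map ε =
        ((etaleThetaDataOfSetting' C hC hS hchar S eS hl).lDeltaTheta.bot).map ε ⊔ ⨆ t, J t ↔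
      (∀ t, (I t).map (phi C) ≤ D.lDeltaTheta l) ∧ D.lDeltaTheta l ≤ ⨆ t, (I t).map (phi C) := by
  rw [← lDeltaSubquotient_top_eq_bot_sup_iSup_iff C I]
  change ((lDeltaSubquotient C).top).map ε = ((lDeltaSubquotient C).bot).map ε ⊔ ⨆ t, J t ↔ _
  simp_rw [← hIJ]
  rw [← Subgroup.map_iSup, ← Subgroup.map_sup]
  exact (Subgroup.map_injective hε).eq_iff

/-- **Consumer-side form over subgroups of `Q` only**: for an injective `ε` and a family `J` of subgroups of
`ε(Π^tp_{X̲̲})` (cuspidal inertia groups of `Π_v ⊆ Π̂^cor_v`), p431116's `hgen` for the genuine bridge holds iff the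
`θ`-images of the pull-backs `ε⁻¹(J t)` lie in and generate `l·Δ_Θ`.
[claim: Mochizuki2012, status: disputed] (IUTchII §2 Cor 2.5 (i), kurims p.71) -/
theorem etaleThetaDataOfSetting'_hgen_iff_comap (hC : D.Compat) (hS : D.Sec2Hyps)
    (hchar : PiYddCharacteristic C) (S : ThetaSetting.{0}) (eS : (Pi C) ≃ₜ* S.PiX) (hl : S.l = l)
    {Q : Type*} [Group Q] (ε : Pi C →* Q) (hε : Function.Injective ε) {ι : Sort*} (J : ι → Subgroup Q)
    (hJ : ∀ t, J t ≤ ε.range) :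
    ((etaleThetaDataOfSetting' C hC hS hchar S eS hl).lDeltaTheta.top).map ε =
        ((etaleThetaDataOfSetting' C hC hS hchar S eS hl).lDeltaTheta.bot).map ε ⊔ ⨆ t, J t ↔
      (∀ t, ((J t).comap ε).map (phi C) ≤ D.lDeltaTheta l) ∧
        D.lDeltaTheta l ≤ ⨆ t, ((J t).comap ε).map (phi C) :=
  etaleThetaDataOfSetting'_hgen_iff C hC hS hchar S eS hl ε hε (fun t => (J t).comap ε) J
    (fun t => by rw [Subgroup.map_comap_eq, inf_eq_right.2 (hJ t)])

/-! ### 2. The clause from the `Π^tp_X`-level cusp-position clause «`toTheta(I_x) = Δ_Θ`» -/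

/-- The subgroup `A ∩ Π^tp_{X̲̲}` of `Π^tp_X`, viewed inside `Π := Π^tp_{X̲̲}`, maps under `φ = toTheta ∘ incl` onto
`toTheta(A ∩ Π^tp_{X̲̲})`. [cite: MochizukiEtTh2009, Def 2.5 (i) p.39] -/
theorem map_phi_subgroupOf (A : Subgroup D.PiTemp) :
    ((A ⊓ C.Huu).subgroupOf C.Huu : Subgroup (Pi C)).map (phi C) = (A ⊓ C.Huu).map D.toTheta := by
  change (((A ⊓ C.Huu).subgroupOf C.Huu).map (D.toTheta.comp C.Huu.subtype)) = _
  rw [← Subgroup.map_map, Subgroup.map_subgroupOf_eq_of_le inf_le_right]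

/-- **The clause from the cusp-position clause.** If a subgroup `I₀ ⊆ Π^tp_X` — the inertia group `I_x` of a cusp
`x` of `X` ([SemiAnbd] §6 p. 71, `D.inertia x`) — maps under `toTheta` ONTO `Δ_Θ` ([EtTh] §2 p. 35 «maps the
inertia group `I_x ⊆ D_x` isomorphically onto `Δ̄_Θ`», `Ẑ`-level form; the binder family of GAP-LEDGER
G-L2t10-3), and `Ker(Π^tp_X ↠ (Π^tp_X)^Θ) ⊆ Π^tp_{X̲̲}` (the covering `X̲̲ → X` is dominated by the theta quotient,
[EtTh] Def. 2.1–2.5), then `φ(I₀ ∩ Π^tp_{X̲̲}) = l·Δ_Θ` — by abc-iut-L2-t8's `map_toTheta_Huu`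
(«`toTheta(Π^tp_{X̲̲}) ∩ Δ_Θ = l·Δ_Θ`», Prop. 2.2 (ii) / Prop. 2.12 (i)). [cite: MochizukiEtTh2009, Def 2.5 (i) p.39] -/
theorem map_phi_inf_eq_lDeltaTheta (I₀ : Subgroup D.PiTemp) (hI₀ : I₀.map D.toTheta = D.DeltaTheta)
    (hker : D.toTheta.ker ≤ C.Huu) :
    ((I₀ ⊓ C.Huu).subgroupOf C.Huu : Subgroup (Pi C)).map (phi C) = D.lDeltaTheta l := by
  rw [map_phi_subgroupOf, ← C.map_toTheta_Huu]
  apply le_antisymm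
  · rintro _ ⟨i, ⟨hiI, hiH⟩, rfl⟩
    exact ⟨⟨i, hiH, rfl⟩, hI₀ ▸ ⟨i, hiI, rfl⟩⟩
  · rintro z ⟨⟨h, hh, rfl⟩, hz⟩
    rw [← hI₀] at hz
    obtain ⟨i, hi, hih⟩ := hz
    -- `i = (i h⁻¹) · h` with `i h⁻¹ ∈ Ker toTheta ⊆ Π^tp_{X̲̲}`, so `i ∈ I₀ ∩ Π^tp_{X̲̲}`
    have hk : i * h⁻¹ ∈ D.toTheta.ker := by
      rw [MonoidHom.mem_ker, map_mul, map_inv, hih, mul_inv_cancel]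
    have hiHuu : i ∈ C.Huu := by
      have := C.Huu.mul_mem (hker hk) hh
      rwa [inv_mul_cancel_right] at this
    exact ⟨i, ⟨hi, hiHuu⟩, hih⟩

/-- The same for the inertia group of a cusp `x` of `X` under its printed name `I_x = D.inertia x`
([SemiAnbd] §6 p. 71). [cite: MochizukiEtTh2009, Def 2.5 (i) p.39] -/
theorem map_phi_inertia_inf_eq_lDeltaTheta (x : D.Pt) (hx : (D.inertia x).map D.toTheta = D.DeltaTheta)
    (hker : D.toTheta.ker ≤ C.Huu) :
    ((D.inertia x ⊓ C.Huu).subgroupOf C.Huu : Subgroup (Pi C)).map (phi C) = D.lDeltaTheta l :=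
  map_phi_inf_eq_lDeltaTheta C (D.inertia x) hx hker

/-- **Single-cusp `hgen` from the cusp-position clause**: under «`toTheta(I_x) = Δ_Θ`» and
«`Ker toTheta ⊆ Π^tp_{X̲̲}`», the top group of the genuine `(l·Δ_Θ)(Π^tp_{X̲̲})` is generated over its bottom group
by the ONE subgroup `I_x ∩ Π^tp_{X̲̲}`. [claim: Mochizuki2012, status: disputed] (IUTchII §2 Cor 2.5 (i), kurims p.71) -/
theorem lDeltaSubquotient_top_eq_bot_sup_inertia (x : D.Pt)
    (hx : (D.inertia x).map D.toTheta = D.DeltaTheta) (hker : D.toTheta.ker ≤ C.Huu) :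
    (lDeltaSubquotient C).top =
      (lDeltaSubquotient C).bot ⊔ ((D.inertia x ⊓ C.Huu).subgroupOf C.Huu : Subgroup (Pi C)) :=
  lDeltaSubquotient_top_eq_bot_sup C _ (map_phi_inertia_inf_eq_lDeltaTheta C x hx hker)

/-- **The consumer's `hgen` for `etaleThetaDataOfSetting'` from the cusp-position clause**: for every
push-forward `ε` and every family `J` of `ε`-images of subgroups `I t ≤ Π^tp_{X̲̲}` with `φ(I t) ⊆ l·Δ_Θ` («cuspidal
inertia groups of `Π_v`»), ONE of which is `I_x ∩ Π^tp_{X̲̲}` for a cusp `x` of `X` with «`toTheta(I_x) = Δ_Θ`»,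
and «`Ker toTheta ⊆ Π^tp_{X̲̲}`»: `(top).map ε = (bot).map ε ⊔ ⨆ t, J t`.
[claim: Mochizuki2012, status: disputed] (IUTchII §2 Cor 2.5 (i), kurims p.71) -/
theorem etaleThetaDataOfSetting'_hgen_of_cuspPosition (hC : D.Compat) (hS : D.Sec2Hyps)
    (hchar : PiYddCharacteristic C) (S : ThetaSetting.{0}) (eS : (Pi C) ≃ₜ* S.PiX) (hl : S.l = l)
    {Q : Type*} [Group Q] (ε : Pi C →* Q) {ι : Sort*} (I : ι → Subgroup (Pi C)) (J : ι → Subgroup Q)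
    (hIJ : ∀ t, (I t).map ε = J t) (hle : ∀ t, (I t).map (phi C) ≤ D.lDeltaTheta l)
    (x : D.Pt) (hx : (D.inertia x).map D.toTheta = D.DeltaTheta) (hker : D.toTheta.ker ≤ C.Huu)
    (t₀ : ι) (ht₀ : I t₀ = ((D.inertia x ⊓ C.Huu).subgroupOf C.Huu : Subgroup (Pi C))) :
    ((etaleThetaDataOfSetting' C hC hS hchar S eS hl).lDeltaTheta.top).map ε =
      ((etaleThetaDataOfSetting' C hC hS hchar S eS hl).lDeltaTheta.bot).map ε ⊔ ⨆ t, J t := by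
  refine etaleThetaDataOfSetting'_hgen C hC hS hchar S eS hl ε I J hIJ hle ?_
  calc D.lDeltaTheta l = (I t₀).map (phi C) := by
        rw [ht₀, map_phi_inertia_inf_eq_lDeltaTheta C x hx hker]
    _ ≤ ⨆ t, (I t).map (phi C) := le_iSup (fun t => (I t).map (phi C)) t₀

end EtaleThetaDataOfSetting

end Literature.IUT.HodgeArakelov

end
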